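import Literature.NumberTheory.EllipticCurves.IwasawaSelmerControlExactCountProofs
import Literature.NumberTheory.EllipticCurves.IwasawaSelmerControlLocalizationProofs
import Literature.NumberTheory.EllipticCurves.SelmerCorankControlRatProofs
import Literature.NumberTheory.EllipticCurves.Greenberg1999.ControlLocalKernelsLayerGoodProofs
import HarnessLib

set_option linter.dupNamespace false -- `…BirchSwinnertonDyer.BirchSwinnertonDyer…` is the cell's nested layout (D-0017)
set_option autoImplicit false

/-!
# `ker g₀ ↪ ker r₀` IN EVERY RANK: Greenberg's `A₀/Sel₀` embeds in `∏_{v ∈ S} 𝒦_{v,0}[p^∞]`, so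
# `#(A₀/Sel₀) ∣ ∏_{v ∈ S} #𝒦_{v,0}[p^∞]` with NO finiteness of `Sel_{p^∞}(E/K)` (a brick for the `Ш`-free kernel-index road to C3′)

Cell `bsd-f1-sign2`, WIDTH-5 attach seat `bsd-line-att-p3` g10, route `AlignedTransportAtTwo`, crux C3′ `BSDOfMainConjectureRankOneAtTwo`
(stmt-BirchSwinnertonDyer-23008), `--supports` it. THEOREMS ONLY (no definition, no named fact, no `sorry`). BSD is NOT proved; C3′ is NOT
closed; nothing here is specific to `p = 2`.

WHY. On the C3′ cell the ONE open stub (`F1Sign2.SchneiderLeadingTermFormulaAtTwoSq`) is, curve by curve and modulo Greenberg Prop. 4.14, the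
`Ш`-FREE KERNEL-INDEX statement of att-p4 g7 (`…EulerCharAtTwoAssemblyDivisible.schneiderLeadingTermFormulaAtTwoSqAt_iff_kerIndexAt_of_prop414`,
skeleton proposal `Cruxes/BSDOfMainConjectureRankOneAtTwo/Lines/birth_v7_kerindex_proposal_att_p4g7.lean`):
`#ker θ · #(A₀/Sel₀) · (log₂5)^{rank} = u · Reg₂(Dh) · 2^{v₂(∏c_v)} · #Ẽ(𝔽₂)(2)²`, whose LOCAL half (L) is Greenberg's index `#(A₀/Sel₀)`
(`WeierstrassCurve.KerG κ 0`, `A₀ = h₀⁻¹(Sel_∞) ⊆ H¹(K, E[p^∞])`) against the local orders `#𝒦_{v,0}[p^∞]` (`= c_v^{(p)}` at bad `v ∤ p`,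
Lemma 3.3; `= #Ẽ(𝔽_p)(p)²` at good ordinary `v ∣ p`, Lemma 3.4). In RANK ZERO (`Sel_{p^∞}(E/K)` finite, `E(K)[p] = 0`) the tree has the EXACT
count `#(A₀/Sel₀) = ∏_{v ∈ S} #𝒦_{v,0}[p^∞]` from Cassels' theorem (`…Theorems.InputsGreenbergKerG.natCard_kerG_zero_eq_prod`, Greenberg L.4.7).
In POSITIVE rank (the C3′ cell has rank one) Cassels' surjectivity fails — the global-to-local cokernel is `(E(K) ⊗ ℤ_p)^∨`-sized — and the
exact value of `#(A₀/Sel₀)` is `∏ #𝒦 / [E(K) ⊗ ℤ_p : E_𝒦]` (`E_𝒦` = points locally orthogonal to every `𝒦_{v,0}` under the Tate pairings;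
Cassels–Poitou–Tate with the Kummer classes of `E(K)` as surviving test classes — NOT in the tree). This file lands the half that needs no
duality, valid in every rank, for every number field `K`, every prime `p` and EVERY `ℤ_p`-extension `κ` (cyclotomicity is not used):

* §1 `exists_kerG_zero_embedding` — the evaluation map `y ↦ (loc_v y)_{v ∈ S}` induces an INJECTIVE homomorphism
  `Ψ : A₀/Sel₀ →+ ∏_{v ∈ S} 𝒦_{v,0}[p^∞]` as soon as `𝒦_{v,0}[p^∞] = 0` off `S` (its kernel is `Sel₀`: a class of `A₀` with all `S`-localisations
  zero is Selmer — `mem_selmerLayer_of_forall_localResOver_conjH1_eq_zero` at layer `0` with the single coset representative `1`); the extraction,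
  as a standalone theorem, of the injectivity half of `natCard_kerG_zero_eq_prod` (whose statement carries `Sel` finite and `E(K)[p] = 0`).
* §1 `natCard_kerG_zero_dvd_prod` — **`#(A₀/Sel₀) ∣ ∏_{v ∈ S} #𝒦_{v,0}[p^∞]`** unconditionally (Lagrange for the image of `Ψ`; if some factor is
  infinite both sides read through `Nat.card = 0`), and `finite_kerG_zero_of_forall_finite` (finite local factors ⇒ `A₀/Sel₀` finite).
* §2 the same with the hypothesis in Greenberg's form «`S ⊇ {v ∣ p} ∪ {bad v}`» (`𝒦_{v,0}[p^∞] = 0` at a good `v ∤ p` is the tree theorem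
  `Greenberg1999.localTowerKerPrimary_eq_bot_of_hasGoodReductionAt`, Lemma 3.3): `natCard_kerG_zero_dvd_prod_of_good`, and its `K = ℚ`
  reading `natCard_kerG_zero_dvd_prod_rat` — on a C3′ cell curve the factor `#(A₀/Sel₀)` of the kernel-index statement DIVIDES
  `∏_{v ∈ S} #𝒦_{v,0}[2^∞]` (`= 2^{v₂(∏ c_v)} · #Ẽ(𝔽₂)(2)²` by Lemmas 3.3/3.4), whatever the rank.
What is NOT done: the cokernel of `Ψ` (the Cassels–Poitou–Tate index `[E(K) ⊗ ℤ_p : E_𝒦]`), i.e. the other half of (L); and (H) (derived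
height = `Σ²` height). Those remain the honest «what is missing» of the kernel-index road.

References: [GreenbergLNM1716] §3 pp. 85–90 (the control diagram, `ker g_n ⊆ ker r_n` componentwise, Lemmas 3.3–3.5), §4 Lemma 4.7 pp. 107–108;
[CoatesSujatha2000GaloisCohomology] Ch. 3 (the fundamental diagram).
-/

noncomputable section

open scoped Classical NumberField

open NumberField IsDedekindDomain Field

namespace Summit.BirchSwinnertonDyer.BirchSwinnertonDyer.Theorems.AlignedTransportAtTwoEulerCharAtTwoKerGEmbedding

open Literature.NumberTheory.EllipticCurves Literature.NumberTheory.GaloisRepresentations WeierstrassCurve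

universe u

variable {K : Type u} [Field K] [NumberField K] (W : WeierstrassCurve K) (p : ℕ) [hp : Fact p.Prime]
  (κ : ZpExtension K p)

/-! ## §1 The evaluation embedding `A₀/Sel₀ ↪ ∏_{v ∈ S} 𝒦_{v,0}[p^∞]` and the divisibility, for every `ℤ_p`-extension -/

/-- **`ker g₀ ↪ ∏_{v ∈ S} ker r_{v,0}` (every rank, every `ℤ_p`-extension).** If the `p`-power torsion of the local tower kernel vanishes at
the finite places off `S`, the evaluation map `y ↦ (loc_v y)_{v ∈ S}` on `A₀ = h₀⁻¹(Sel_{p^∞}(E/K_∞))` induces an INJECTIVE homomorphism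
`A₀/Sel₀ →+ ∏_{v ∈ S} 𝒦_{v,0}[p^∞]`, computed on representatives by `loc_v`. (Values lie in `𝒦_{v,0}`: `localResOver_conjH1_mem_localTowerKer_of_mem`;
`p`-power torsion: every class of `H¹(K, E[p^∞])` is; kernel `= Sel₀`: `mem_selmerLayer_of_forall_localResOver_conjH1_eq_zero` at layer `0`.)
[cite: GreenbergLNM1716, §3 pp. 85–86 and p. 90 (ker g ⊆ ker r componentwise; Lemma 3.5)] -/
theorem exists_kerG_zero_embedding (S : Finset (HeightOneSpectrum (𝓞 K)))
    (h0 : ∀ v ∉ S, W.localTowerKerPrimary κ (v.adicCompletion K) 0 = ⊥) :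
    ∃ Ψ : W.KerG κ 0 →+ (∀ v : S, W.localTowerKerPrimary κ (v.1.adicCompletion K) 0),
      Function.Injective Ψ ∧
        ∀ (y : W.selmerInftyPreimage κ 0) (v : S),
          ((Ψ (y : W.KerG κ 0) v : W.localTowerKerPrimary κ (v.1.adicCompletion K) 0) :
              discreteH1 (localSubgroup (κ.layerSubgroup 0) (v.1.adicCompletion K)) (localPoints W (v.1.adicCompletion K))) =
            W.localResOver p (κ.layerSubgroup 0) (v.1.adicCompletion K) y := by
  -- notation
  let A : AddSubgroup (W.subgroupH1 p (κ.layerSubgroup 0)) := W.selmerInftyPreimage κ 0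
  let Sel₀ : AddSubgroup (W.subgroupH1 p (κ.layerSubgroup 0)) := W.selmerLayer κ 0
  let T : HeightOneSpectrum (𝓞 K) → Type u := fun v ↦ W.localTowerKerPrimary κ (v.adicCompletion K) 0
  let loc : ∀ v : HeightOneSpectrum (𝓞 K), W.subgroupH1 p (κ.layerSubgroup 0) →+
      discreteH1 (localSubgroup (κ.layerSubgroup 0) (v.adicCompletion K)) (localPoints W (v.adicCompletion K)) :=
    fun v ↦ W.localResOver p (κ.layerSubgroup 0) (v.adicCompletion K)
  have hone : ∀ y : W.subgroupH1 p (κ.layerSubgroup 0), W.conjH1 p (κ.layerSubgroup 0) 1 y = y := fun y ↦ by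
    rw [W.conjH1_one_holds p (κ.layerSubgroup 0), AddMonoidHom.id_apply]
  -- `loc_v y ∈ 𝒦_{v,0}[p^∞]` for `y ∈ A₀`
  have hmemT : ∀ (y : W.subgroupH1 p (κ.layerSubgroup 0)), y ∈ A → ∀ v, loc v y ∈ W.localTowerKerPrimary κ (v.adicCompletion K) 0 := by
    intro y hy v
    obtain ⟨k, hk⟩ := W.exists_pow_smul_subgroupH1_layer_eq_zero κ 0 y
    refine (W.mem_localTowerKerPrimary_iff κ _ 0 _).mpr ⟨?_, k, by rw [← map_nsmul, hk, map_zero]⟩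
    have h := W.localResOver_conjH1_mem_localTowerKer_of_mem κ hy v 1
    rwa [hone] at h
  -- the evaluation map `Φ : A₀ → ∏_{v ∈ S} 𝒦_{v,0}[p^∞]`
  let Φ : A →+ (∀ v : S, T v) :=
    { toFun := fun y v ↦ ⟨loc v y, hmemT y y.2 v⟩
      map_zero' := funext fun v ↦ Subtype.ext (by simp)
      map_add' := fun y y' ↦ funext fun v ↦ Subtype.ext (by simp) }
  have hΦ : ∀ (y : A) (v : S), ((Φ y v : T v) : _) = loc v y := fun _ _ ↦ rfl
  -- `Φ y = 0 ↔ y ∈ Sel₀`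
  have hker : ∀ y : A, Φ y = 0 ↔ (y : W.subgroupH1 p (κ.layerSubgroup 0)) ∈ Sel₀ := by
    intro y
    constructor
    · intro hy0
      refine W.mem_selmerLayer_of_forall_localResOver_conjH1_eq_zero κ S h0 (fun _ ↦ {1}) (fun v _ σ ↦ ?_) y.2 ?_
      · refine ⟨1, Finset.mem_singleton_self _, 1, σ, ?_, by rw [map_one, one_mul, one_mul]⟩
        rw [ZpExtension.layerSubgroup_zero]; exact Subgroup.mem_top σ
      · intro v hv ρ hρ
        rw [Finset.mem_singleton] at hρ
        rw [hρ, hone]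
        have h : ((Φ y ⟨v, hv⟩ : T v) : discreteH1 (localSubgroup (κ.layerSubgroup 0) (v.adicCompletion K))
            (localPoints W (v.adicCompletion K))) = 0 := by
          rw [hy0]; rfl
        rw [hΦ] at h
        exact h
    · intro hy
      funext v
      apply Subtype.ext
      rw [hΦ]
      change loc v y = 0
      have h := ((W.mem_selmerGroupOver_iff p (κ.layerSubgroup 0) _).mp hy).1 v 1
      rwa [hone, mem_localKerOver_iff] at h
  -- descend to `A₀/Sel₀`
  have hle : Sel₀.addSubgroupOf A ≤ Φ.ker := fun y hy ↦ (AddMonoidHom.mem_ker).mpr ((hker y).mpr hy)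
  let Ψ : W.KerG κ 0 →+ (∀ v : S, T v) := QuotientAddGroup.lift (Sel₀.addSubgroupOf A) Φ hle
  have hΨmk : ∀ y : A, Ψ (y : W.KerG κ 0) = Φ y := fun y ↦ QuotientAddGroup.lift_mk _ hle y
  have hinj : Function.Injective Ψ := by
    refine (injective_iff_map_eq_zero Ψ).mpr fun q hq ↦ ?_
    induction q using QuotientAddGroup.induction_on with
    | H y =>
      rw [hΨmk] at hq
      exact (QuotientAddGroup.eq_zero_iff y).mpr ((hker y).mp hq)
  exact ⟨Ψ, hinj, fun y v ↦ by rw [hΨmk]; exact hΦ y v⟩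

/-- **`#(A₀/Sel₀) ∣ ∏_{v ∈ S} #𝒦_{v,0}[p^∞]`, every rank, every `ℤ_p`-extension** (no finiteness of `Sel_{p^∞}(E/K)`, no `E(K)[p] = 0`):
Lagrange for the image of the embedding of `exists_kerG_zero_embedding` (both sides are `Nat.card`s; an infinite local factor makes the right
side `0`). The rank-zero EQUALITY is `InputsGreenbergKerG.natCard_kerG_zero_eq_prod` (Cassels); in positive rank the quotient is the
Cassels–Poitou–Tate index, not computed here. [cite: GreenbergLNM1716, §3 p. 90 (Lemma 3.5) and §4 Lemma 4.7 (pp. 107–108)] -/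
theorem natCard_kerG_zero_dvd_prod (S : Finset (HeightOneSpectrum (𝓞 K)))
    (h0 : ∀ v ∉ S, W.localTowerKerPrimary κ (v.adicCompletion K) 0 = ⊥) :
    Nat.card (W.KerG κ 0) ∣ ∏ v ∈ S, Nat.card (W.localTowerKerPrimary κ (v.adicCompletion K) 0) := by
  obtain ⟨Ψ, hΨ, -⟩ := exists_kerG_zero_embedding W p κ S h0
  rw [← Finset.prod_coe_sort S (fun v ↦ Nat.card (W.localTowerKerPrimary κ (v.adicCompletion K) 0)), ← Nat.card_pi]
  exact AddSubgroup.card_dvd_of_injective Ψ hΨ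

/-- **`A₀/Sel₀` is finite as soon as the local factors `𝒦_{v,0}[p^∞]`, `v ∈ S`, are** (every rank, every `ℤ_p`-extension).
[cite: GreenbergLNM1716, §3 Lemma 3.5 (p. 90)] -/
theorem finite_kerG_zero_of_forall_finite (S : Finset (HeightOneSpectrum (𝓞 K)))
    (h0 : ∀ v ∉ S, W.localTowerKerPrimary κ (v.adicCompletion K) 0 = ⊥)
    (hfin : ∀ v ∈ S, Finite (W.localTowerKerPrimary κ (v.adicCompletion K) 0)) : Finite (W.KerG κ 0) := by
  obtain ⟨Ψ, hΨ, -⟩ := exists_kerG_zero_embedding W p κ S h0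
  haveI : ∀ v : S, Finite (W.localTowerKerPrimary κ (v.1.adicCompletion K) 0) := fun v ↦ hfin v.1 v.2
  exact Finite.of_injective Ψ hΨ

/-! ## §2 Greenberg's form of the hypothesis: `S ⊇ {v ∣ p} ∪ {bad places}` -/

/-- **`#(A₀/Sel₀) ∣ ∏_{v ∈ S} #𝒦_{v,0}[p^∞]` for an elliptic curve and any finite `S` containing the places above `p` and the bad places**
(off `S`, `𝒦_{v,0}[p^∞] = 0` is Greenberg's Lemma 3.3 at a good `v ∤ p`, tree theorem `Greenberg1999.localTowerKerPrimary_eq_bot_of_hasGoodReductionAt`).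
Every rank; every `ℤ_p`-extension. [cite: GreenbergLNM1716, §3 Lemma 3.3 (p. 87) and p. 90] -/
theorem natCard_kerG_zero_dvd_prod_of_good [W.IsElliptic] (S : Finset (HeightOneSpectrum (𝓞 K)))
    (hS : ∀ v ∉ S, ((p : ℕ) : 𝓞 K) ∉ v.asIdeal ∧ W.HasGoodReductionAt v) :
    Nat.card (W.KerG κ 0) ∣ ∏ v ∈ S, Nat.card (W.localTowerKerPrimary κ (v.adicCompletion K) 0) :=
  natCard_kerG_zero_dvd_prod W p κ S fun v hv ↦
    Greenberg1999.localTowerKerPrimary_eq_bot_of_hasGoodReductionAt W κ (hS v hv).1 (hS v hv).2 0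

/-- The embedding under Greenberg's hypothesis (elliptic `W`, `S ⊇ {v ∣ p} ∪ {bad}`). [cite: GreenbergLNM1716, §3 pp. 86–90] -/
theorem exists_kerG_zero_embedding_of_good [W.IsElliptic] (S : Finset (HeightOneSpectrum (𝓞 K)))
    (hS : ∀ v ∉ S, ((p : ℕ) : 𝓞 K) ∉ v.asIdeal ∧ W.HasGoodReductionAt v) :
    ∃ Ψ : W.KerG κ 0 →+ (∀ v : S, W.localTowerKerPrimary κ (v.1.adicCompletion K) 0),
      Function.Injective Ψ ∧
        ∀ (y : W.selmerInftyPreimage κ 0) (v : S),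
          ((Ψ (y : W.KerG κ 0) v : W.localTowerKerPrimary κ (v.1.adicCompletion K) 0) :
              discreteH1 (localSubgroup (κ.layerSubgroup 0) (v.1.adicCompletion K)) (localPoints W (v.1.adicCompletion K))) =
            W.localResOver p (κ.layerSubgroup 0) (v.1.adicCompletion K) y :=
  exists_kerG_zero_embedding W p κ S fun v hv ↦
    Greenberg1999.localTowerKerPrimary_eq_bot_of_hasGoodReductionAt W κ (hS v hv).1 (hS v hv).2 0

/-- **The `K = ℚ` reading for the C3′ kernel-index road** (any prime `p`, any `ℤ_p`-extension of `ℚ`, any rank): for `W/ℚ` elliptic and a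
finite set `S` of primes containing `p` and the bad primes, the factor `#(A₀/Sel₀) = Nat.card (W.KerG κ 0)` of the `Ш`-free kernel-index
statement divides `∏_{v ∈ S} #𝒦_{v,0}[p^∞]`. (On the C3′ cell, `p = 2` good ordinary: the right side is `2^{v₂(∏ c_v)} · #Ẽ(𝔽₂)(2)²` by
Greenberg's Lemmas 3.3/3.4 — named facts, not used here.) [cite: GreenbergLNM1716, §3 Lemmas 3.3–3.5, §4 Lemma 4.7] -/
theorem natCard_kerG_zero_dvd_prod_rat (W : WeierstrassCurve ℚ) [W.IsElliptic] (κ : ZpExtension ℚ p)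
    (S : Finset (HeightOneSpectrum (𝓞 ℚ))) (hS : ∀ v ∉ S, ((p : ℕ) : 𝓞 ℚ) ∉ v.asIdeal ∧ W.HasGoodReductionAt v) :
    Nat.card (W.KerG κ 0) ∣ ∏ v ∈ S, Nat.card (W.localTowerKerPrimary κ (v.adicCompletion ℚ) 0) :=
  natCard_kerG_zero_dvd_prod_of_good W p κ S hS

end Summit.BirchSwinnertonDyer.BirchSwinnertonDyer.Theorems.AlignedTransportAtTwoEulerCharAtTwoKerGEmbedding

end
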